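/-
Copyright: harness cell b2b-lgcu-borel (gen 16).  Honest framing: the VALUE here is a THEOREM
(all primes, unconditional) — NOT summit progress; the crux item `SubgroupIdentityDesigns`
(stmt-MatrixMultiplication-14079) stays open and untouched.
-/
import Mathlib
import Summits.MatrixMultiplication.MatrixMultiplication.Theorems.SubgroupIdentityDesigns.Negative.NormaliserImages
import Summits.MatrixMultiplication.MatrixMultiplication.Theorems.SubgroupIdentityDesigns.Negative.FullImageSplit

/-!
# The Singer cycle inside its normaliser: unique involution, index two, and `p ≡ 1 (mod 4)`

Route `LevelGradedCohnUmans`, crux `SubgroupIdentityDesigns`, negative side, cell `(m,k) = (2,1)`.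
Unconditional group theory in `GL₂(𝔽_p)` used by `DicksonFamilyI` / `FamilyIArithmetic` to pin the
arithmetic of the "family I" witnesses:

* `two_mul_le_of_dvd_of_ne` — a proper divisor is at most half;
* `card_eq_scalar_mul_card_image` (all `m ≥ 1`) — `|H| = |S_H| · |HZ/Z|` EXACTLY
  (`S_H = scalarHom⁻¹(H) ≅ H ∩ Z` is the kernel of `H → GL/Z`; cf. the inequality
  `ImageCeiling.card_le_scalar_mul_card_image`);
* `singerPlusSubgroup n` — the Singer cycle `C = {[[x, n y],[y, x]]}` (shape⁺) inside its
  normaliser `singerNormalSubgroup n` of `NormaliserImages`; `singerPlus_involution` (`p ≠ 2`,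
  `n` a non-square): an involution of shape⁺ is `-1` — `C` has a unique element of order two;
* `card_le_two_mul_card_inf_plus` — a subgroup `H' ≤ N(C)` has `|H'| ≤ 2 |H' ∩ C|`;
* **`mod_four_of_conj_singerNormal`** (`p ≠ 2`) — a subgroup conjugate into `N(C)` with projective
  image of order `p + 1` and scalar part `S` of ODD order forces `p ≡ 1 (mod 4)`: its conjugate
  `H'` has order `|S|(p+1)`, `-1 ∉ H'`, so `H' ∩ C` has odd order (Cauchy + unique involution), is
  proper of index two, and `|S|(p+1)/2` odd gives `4 ∣ p - 1`.

VALUE = THEOREM (unconditional, all `p`), NOT summit progress; the crux item is untouched and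
remains open.  Report: `run/shared/lean/b2b/levelgraded-cu/ORACLE-g16.md` §G16-1.
-/

set_option linter.dupNamespace false

noncomputable section

open scoped Classical
open Summit.MatrixMultiplication.MatrixMultiplication.Theorems.LieRankDesigns.Negative (GLm Mat)
open Literature.NumberTheory.EllipticCurves.BinaryQuartic (two_ne_zero_zmod)

namespace Summit.MatrixMultiplication.MatrixMultiplication.Theorems.SubgroupIdentityDesigns.Negative

section SingerCycleOrder

variable {p : ℕ} [hp : Fact p.Prime]

omit hp in
/-- A proper divisor is at most half: `d ∣ n`, `d ≠ n`, `0 < n` give `2d ≤ n`. -/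
theorem two_mul_le_of_dvd_of_ne {d n : ℕ} (hdvd : d ∣ n) (hne : d ≠ n) (hn : 0 < n) :
    2 * d ≤ n := by
  obtain ⟨k, hk⟩ := hdvd
  have hk1 : k ≠ 1 := by
    rintro rfl
    exact hne (by rw [hk, mul_one])
  have hk0 : k ≠ 0 := by
    rintro rfl
    rw [hk, mul_zero] at hn
    exact lt_irrefl 0 hn
  have hk2 : 2 ≤ k := by omega
  calc 2 * d = d * 2 := by ring
    _ ≤ d * k := Nat.mul_le_mul_left d hk2
    _ = n := hk.symm

/-! ## Exact order `|H| = |H ∩ Z| · |HZ/Z|` -/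

/-- `|H| = |S_H| · |HZ/Z|` for every subgroup `H ≤ GL_m(𝔽_p)`, `m ≥ 1` (`S_H = scalarHom⁻¹(H)`):
the kernel of `H → GL/Z` is `H ∩ Z ≅ S_H`. -/
theorem card_eq_scalar_mul_card_image {m : ℕ} [NeZero m] (H : Subgroup (GLm p m)) :
    Nat.card H = Nat.card (H.comap (scalarHom p m)) *
      Nat.card (H.map (QuotientGroup.mk' (scalarHom p m).range)) := by
  classical
  let π := QuotientGroup.mk' (scalarHom p m).range
  let K : Subgroup H := (π.comp H.subtype).ker
  have e1 : Nat.card H = Nat.card K * K.index := by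
    rw [mul_comm]; exact (Subgroup.index_mul_card K).symm
  have e2 : K.index = Nat.card (H.map π) := by
    rw [Subgroup.index_ker, MonoidHom.range_comp, H.range_subtype]
  have e3 : Nat.card K = Nat.card (H.comap (scalarHom p m)) := by
    let g : H.comap (scalarHom p m) → K := fun u =>
      ⟨⟨scalarHom p m u, u.2⟩, by
        rw [MonoidHom.mem_ker]
        change π (scalarHom p m u) = 1
        rw [QuotientGroup.mk'_apply, QuotientGroup.eq_one_iff]
        exact ⟨u, rfl⟩⟩
    refine (Nat.card_eq_of_bijective g ⟨?_, ?_⟩).symm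
    · intro u v huv
      have h := congrArg (fun k : K => ((k : H) : GLm p m)) huv
      exact Subtype.ext (scalarHom_injective h)
    · intro k
      have hk : π ((k : H) : GLm p m) = 1 := by
        have := k.2
        rw [MonoidHom.mem_ker] at this
        simpa using this
      rw [QuotientGroup.mk'_apply, QuotientGroup.eq_one_iff] at hk
      obtain ⟨u, hu⟩ := hk
      refine ⟨⟨u, by rw [Subgroup.mem_comap, hu]; exact (k : H).2⟩, ?_⟩
      apply Subtype.ext
      apply Subtype.ext
      exact hu
  rw [e1, e2, e3]

/-! ## The Singer cycle `C` (shape⁺) inside its normaliser -/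

/-- Shape⁺ `[[x, n y],[y, x]]`: the elements `x + y√n` of the Singer cycle. -/
def IsSingerPlus (n : ZMod p) (g : GLm p 2) : Prop :=
  (g : Mat p 2) 0 1 = n * (g : Mat p 2) 1 0 ∧ (g : Mat p 2) 1 1 = (g : Mat p 2) 0 0

/-- `1` has shape⁺. -/
theorem isSingerPlus_one (n : ZMod p) : IsSingerPlus n (1 : GLm p 2) :=
  ⟨by rw [gl2_one_apply.2.1, gl2_one_apply.2.2.1, mul_zero],
    by rw [gl2_one_apply.1, gl2_one_apply.2.2.2]⟩

/-- shape⁺ · shape⁺ = shape⁺. -/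
theorem isSingerPlus_mul {n : ZMod p} {g h : GLm p 2} (hg : IsSingerPlus n g)
    (hh : IsSingerPlus n h) : IsSingerPlus n (g * h) := by
  obtain ⟨g01, g11⟩ := hg
  obtain ⟨h01, h11⟩ := hh
  constructor <;> simp only [gl2_mul_apply, g01, g11, h01, h11] <;> ring

/-- shape⁻ · shape⁻ = shape⁺. -/
theorem isSingerPlus_of_minus_mul_minus {n : ZMod p} {g h : GLm p 2}
    (hg : (g : Mat p 2) 0 1 = -(n * (g : Mat p 2) 1 0) ∧ (g : Mat p 2) 1 1 = -(g : Mat p 2) 0 0)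
    (hh : (h : Mat p 2) 0 1 = -(n * (h : Mat p 2) 1 0) ∧ (h : Mat p 2) 1 1 = -(h : Mat p 2) 0 0) :
    IsSingerPlus n (g * h) := by
  obtain ⟨g01, g11⟩ := hg
  obtain ⟨h01, h11⟩ := hh
  constructor <;> simp only [gl2_mul_apply, g01, g11, h01, h11] <;> ring

/-- The SINGER CYCLE `C ≤ GL₂(𝔽_p)` (shape⁺ elements). -/
def singerPlusSubgroup (n : ZMod p) : Subgroup (GLm p 2) :=
  subgroupOfMulClosed {g : GLm p 2 | IsSingerPlus n g} (isSingerPlus_one n)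
    (fun _ hx _ hy => isSingerPlus_mul hx hy)

/-- Membership in the Singer cycle is the shape⁺ condition. -/
theorem mem_singerPlusSubgroup {n : ZMod p} {g : GLm p 2} :
    g ∈ singerPlusSubgroup n ↔
      (g : Mat p 2) 0 1 = n * (g : Mat p 2) 1 0 ∧ (g : Mat p 2) 1 1 = (g : Mat p 2) 0 0 :=
  Iff.rfl

/-- **The Singer cycle has a unique involution** (`p ≠ 2`, `n` a non-square): a shape⁺ element
`g` with `g² = 1` is `1` or `-1`. -/
theorem singerPlus_involution (hp2 : p ≠ 2) {n : ZMod p} (hn : ∀ x : ZMod p, x * x ≠ n)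
    {g : GLm p 2} (hg : IsSingerPlus n g) (h2 : g * g = 1) :
    g = 1 ∨ g = scalarHom p 2 (-1) := by
  obtain ⟨g01, g11⟩ := hg
  have e00 := gl2_mul_apply g g 0 0
  have e10 := gl2_mul_apply g g 1 0
  rw [h2, gl2_one_apply.1] at e00
  rw [h2, gl2_one_apply.2.2.1, g11] at e10
  have hxy : (2 : ZMod p) * ((g : Mat p 2) 1 0 * (g : Mat p 2) 0 0) = 0 := by
    linear_combination -e10
  rcases mul_eq_zero.mp ((mul_eq_zero.mp hxy).resolve_left (two_ne_zero_zmod hp2)) with hy | hx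
  · have h01 : (g : Mat p 2) 0 1 = 0 := by rw [g01, hy, mul_zero]
    rw [h01, zero_mul, add_zero] at e00
    rcases mul_self_eq_one_iff.mp e00.symm with h1 | h1
    · left
      exact gl2_ext (by rw [h1, gl2_one_apply.1]) (by rw [h01, gl2_one_apply.2.1])
        (by rw [hy, gl2_one_apply.2.2.1]) (by rw [g11, h1, gl2_one_apply.2.2.2])
    · right
      obtain ⟨s00, s01, s10, s11⟩ := scalarHom_entries (p := p) (-1 : (ZMod p)ˣ)
      exact gl2_ext (by rw [h1, s00, Units.val_neg, Units.val_one]) (by rw [h01, s01])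
        (by rw [hy, s10]) (by rw [g11, h1, s11, Units.val_neg, Units.val_one])
  · exfalso
    rw [hx, zero_mul, zero_add, g01] at e00
    have hy0 : (g : Mat p 2) 1 0 ≠ 0 := by
      intro h0
      rw [h0] at e00
      simp at e00
    apply hn ((g : Mat p 2) 1 0)⁻¹
    calc ((g : Mat p 2) 1 0)⁻¹ * ((g : Mat p 2) 1 0)⁻¹
        = ((g : Mat p 2) 1 0)⁻¹ * ((g : Mat p 2) 1 0)⁻¹ *
            (n * (g : Mat p 2) 1 0 * (g : Mat p 2) 1 0) := by rw [← e00, mul_one]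
      _ = n * (((g : Mat p 2) 1 0)⁻¹ * (g : Mat p 2) 1 0) *
            (((g : Mat p 2) 1 0)⁻¹ * (g : Mat p 2) 1 0) := by ring
      _ = n := by rw [inv_mul_cancel₀ hy0, mul_one, mul_one]

/-- **Index `≤ 2`**: a subgroup `H' ≤ N(C)` satisfies `|H'| ≤ 2 |H' ∩ C|`. -/
theorem card_le_two_mul_card_inf_plus {n : ZMod p} {H' : Subgroup (GLm p 2)}
    (hH : ∀ x ∈ H', IsSingerNormal n x) :
    Nat.card H' ≤ 2 * Nat.card ((H' ⊓ singerPlusSubgroup n : Subgroup (GLm p 2))) := by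
  classical
  set R : Subgroup (GLm p 2) := H' ⊓ singerPlusSubgroup n with hR
  have hRle : R ≤ H' := inf_le_left
  -- the subgroup R' = R viewed inside H'
  let R' : Subgroup H' := R.subgroupOf H'
  have hcardR' : Nat.card R' = Nat.card R :=
    Nat.card_congr (Subgroup.subgroupOfEquivOfLe hRle).toEquiv
  have hmul : Nat.card R' * R'.index = Nat.card H' := Subgroup.card_mul_index R'
  -- at most two cosets
  have hidx : R'.index ≤ 2 := by
    rw [Subgroup.index_eq_card]
    by_cases hall : ∀ x ∈ H', IsSingerPlus n x
    · -- R' = ⊤ : one coset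
      have h1 : ∀ q : H' ⧸ R', q = ((1 : H') : H' ⧸ R') := by
        intro q
        obtain ⟨x, rfl⟩ := QuotientGroup.mk_surjective q
        rw [QuotientGroup.eq, mul_one, Subgroup.mem_subgroupOf]
        exact R.inv_mem (Subgroup.mem_inf.mpr ⟨x.2, hall _ x.2⟩)
      have : Nat.card (H' ⧸ R') ≤ Nat.card Unit := by
        refine Nat.card_le_card_of_injective (fun _ => ()) ?_
        intro a b _
        rw [h1 a, h1 b]
      simpa using this.trans (by simp)
    · simp only [not_forall] at hall
      obtain ⟨h₀, h₀H, h₀m⟩ := hall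
      have h₀inv_minus : ((h₀⁻¹ : GLm p 2) : Mat p 2) 0 1 = -(n * ((h₀⁻¹ : GLm p 2) : Mat p 2) 1 0) ∧
          ((h₀⁻¹ : GLm p 2) : Mat p 2) 1 1 = -((h₀⁻¹ : GLm p 2) : Mat p 2) 0 0 := by
        rcases hH _ (H'.inv_mem h₀H) with hplus | hminus
        · exfalso
          apply h₀m
          have := (singerPlusSubgroup n).inv_mem (show h₀⁻¹ ∈ singerPlusSubgroup n from hplus)
          rw [inv_inv] at this
          exact this
        · exact hminus
      let f : Bool → H' ⧸ R' := fun b =>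
        if b then ((1 : H') : H' ⧸ R') else ((⟨h₀, h₀H⟩ : H') : H' ⧸ R')
      have hf : Function.Surjective f := by
        intro q
        obtain ⟨x, rfl⟩ := QuotientGroup.mk_surjective q
        by_cases hx : IsSingerPlus n (x : GLm p 2)
        · refine ⟨true, ?_⟩
          simp only [f, if_true]
          rw [QuotientGroup.eq, inv_one, one_mul, Subgroup.mem_subgroupOf]
          exact Subgroup.mem_inf.mpr ⟨x.2, hx⟩
        · refine ⟨false, ?_⟩
          simp only [f, Bool.false_eq_true, if_false]
          rw [QuotientGroup.eq, Subgroup.mem_subgroupOf]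
          have hxm := (hH _ x.2).resolve_left hx
          change h₀⁻¹ * (x : GLm p 2) ∈ R
          refine Subgroup.mem_inf.mpr ⟨H'.mul_mem (H'.inv_mem h₀H) x.2, ?_⟩
          exact isSingerPlus_of_minus_mul_minus h₀inv_minus hxm
      have := Nat.card_le_card_of_surjective f hf
      simpa using this
  have hpos : 0 < Nat.card R' := Nat.card_pos
  calc Nat.card H' = Nat.card R' * R'.index := hmul.symm
    _ ≤ Nat.card R' * 2 := Nat.mul_le_mul_left _ hidx
    _ = 2 * Nat.card R := by rw [hcardR', mul_comm]

/-- **`p ≡ 1 (mod 4)` from one member** (`p ≠ 2`, `n` a non-square): a subgroup conjugate into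
`N(C)` with projective image of order `p + 1` and scalar part of odd order. -/
theorem mod_four_of_conj_singerNormal (hp2 : p ≠ 2) {n : ZMod p}
    (hn : ∀ x : ZMod p, x * x ≠ n) {H : Subgroup (GLm p 2)} {g : GLm p 2}
    (hg : ∀ x ∈ H, IsSingerNormal n (g * x * g⁻¹))
    (hX : Nat.card (H.map (QuotientGroup.mk' (scalarHom p 2).range)) = p + 1)
    (hodd : Odd (Nat.card (H.comap (scalarHom p 2)))) : p % 4 = 1 := by
  classical
  set s := Nat.card (H.comap (scalarHom p 2)) with hs
  set H' := H.map (MulAut.conj g).toMonoidHom with hH'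
  have hmem : ∀ y, y ∈ H' ↔ g⁻¹ * y * g ∈ H := fun y => mem_map_conj_iff'
  have hH'N : ∀ y ∈ H', IsSingerNormal n y := by
    intro y hy
    have e : y = g * (g⁻¹ * y * g) * g⁻¹ := by group
    have h := hg _ ((hmem y).mp hy)
    rw [← e] at h
    exact h
  have hcardH : Nat.card H = s * (p + 1) := by rw [card_eq_scalar_mul_card_image H, hX]
  have hcardH' : Nat.card H' = s * (p + 1) := by
    rw [hH', Subgroup.card_map_of_injective (fun x y h => (MulAut.conj g).injective h)]
    exact hcardH
  -- the scalar -1 is not in H' (its scalar part, = that of H, has odd order)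
  have hneg : scalarHom p 2 (-1) ∉ H' := by
    intro hm
    have hm' : scalarHom p 2 (-1) ∈ H := by
      have h := (hmem _).mp hm
      rwa [mul_assoc, scalarHom_comm, ← mul_assoc, inv_mul_cancel, one_mul] at h
    have hu : (-1 : (ZMod p)ˣ) ∈ H.comap (scalarHom p 2) := by
      rw [Subgroup.mem_comap]; exact hm'
    have h2 : orderOf (-1 : (ZMod p)ˣ) = 2 := by
      refine orderOf_eq_prime (by rw [sq, neg_one_mul, neg_neg]) ?_
      intro h
      have h' := congrArg Units.val h
      rw [Units.val_neg, Units.val_one] at h'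
      exact one_ne_neg_one hp2 h'.symm
    have hdvd := Subgroup.orderOf_dvd_natCard _ hu
    rw [h2] at hdvd
    exact (Nat.not_even_iff_odd.mpr hodd) (even_iff_two_dvd.mpr hdvd)
  -- R = H' ∩ C has odd order
  set R : Subgroup (GLm p 2) := H' ⊓ singerPlusSubgroup n with hR
  have hRodd : Odd (Nat.card R) := by
    by_contra hev
    rw [Nat.not_odd_iff_even, even_iff_two_dvd] at hev
    obtain ⟨r, hr⟩ := exists_prime_orderOf_dvd_card' 2 hev
    have hr2 : ((r : GLm p 2)) * (r : GLm p 2) = 1 := by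
      have h := pow_orderOf_eq_one r
      rw [hr] at h
      have h' := congrArg (fun x : R => (x : GLm p 2)) h
      simpa [pow_two] using h'
    have hr1 : (r : GLm p 2) ≠ 1 := by
      intro h
      have : r = 1 := Subtype.ext h
      rw [this, orderOf_one] at hr
      exact absurd hr (by norm_num)
    obtain ⟨hrH, hrC⟩ := Subgroup.mem_inf.mp r.2
    rcases singerPlus_involution hp2 hn (mem_singerPlusSubgroup.mp hrC) hr2 with h | h
    · exact hr1 h
    · exact hneg (h ▸ hrH)
  -- |R| = |H'| / 2
  have hidx : Nat.card H' ≤ 2 * Nat.card R := card_le_two_mul_card_inf_plus hH'N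
  have hRdvd : Nat.card R ∣ Nat.card H' := Subgroup.card_dvd_of_le inf_le_left
  have hp1even : Even (p + 1) := (hp.out.odd_of_ne_two hp2).add_one
  have hH'even : Even (Nat.card H') := by
    rw [hcardH']; exact Nat.even_mul.mpr (Or.inr hp1even)
  have hne : Nat.card R ≠ Nat.card H' := fun h => (Nat.not_even_iff_odd.mpr hRodd) (h ▸ hH'even)
  have h2R : 2 * Nat.card R ≤ Nat.card H' := two_mul_le_of_dvd_of_ne hRdvd hne Nat.card_pos
  have heq : 2 * Nat.card R = s * (p + 1) := by rw [← hcardH']; exact le_antisymm h2R hidx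
  -- arithmetic
  obtain ⟨t, ht⟩ := hp1even
  have hRst : Nat.card R = s * t := by
    have : 2 * Nat.card R = 2 * (s * t) := by rw [heq, ht]; ring
    omega
  rw [hRst] at hRodd
  obtain ⟨c, hc⟩ := (Nat.odd_mul.mp hRodd).2
  omega

end SingerCycleOrder

end Summit.MatrixMultiplication.MatrixMultiplication.Theorems.SubgroupIdentityDesigns.Negative

end
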